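import Literature.AlgebraicGeometry.Frobenioids.DivisorMonoidTransport
import Literature.AlgebraicGeometry.Frobenioids.Thm49FunctorialBaseIsos
import HarnessLib

/-!
# [FrdI] Thm. 4.9, p. 89 ll. 12–33: the conclusion of row T49-L02 (`SufficesRightEqLeft`) is
# EQUIVALENT to the multiplicativity of the divisor transport `Div φ ↦ Div(Ψ φ)` at every object

Mochizuki, *The geometry of Frobenioids I: the general theory*, Kyushu J. Math. **62** (2008)
293–400, §4, proof of Theorem 4.9 (Kyushu text p. 370 ll. 12–33) [cite: MochizukiFrdI2008, Thm. 4.9 p.89]: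

> "… it follows immediately from the construction of the isomorphism of functors `Ψ^Prime` in the
> proof of Theorem 4.2 (ii) that `Ψ^Prime` extends, for `A_i ∈ Ob(C_i^bs-iso)` …, to an isomorphism
> of monoids `Φ₁^pf(A₁)_𝔭₁ ≅ Φ₂^pf(A₂)_𝔭₂` which is functorial in `A₁` … hence determines an
> isomorphism of monoids `Φ₁(A₁) ≅ Φ₂(A₂)` which is functorial in `A₁` …".

PROOF-ONLY companion (seat abc-iut-w4-d099; no definitions, nothing asserted as a `Prop`). The
divisor transport `T_A : Φ₁(A) → Φ₂(Ψ A)`, `Div φ ↦ Div(Ψ φ)` (pre-steps `φ` out of `A`), exists at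
EVERY object as a bijection respecting divisibility (`PreFrobenioid.exists_divTransport`,
`DivisorMonoidTransport.lean`) and is unique (Def. 1.3 (iii)(d)). This file records, in a
`FrdI.T42.Setting`, that the CONCLUSION of `FrdI.T49.SufficesRightEqLeft` — a family of monoid
isomorphisms `m_A : Φ₁(A) ≃* Φ₂(Ψ A)` with `m_A(Div φ) = Div(Ψ φ)`, natural on `C₁` — holds iff every
such transport is multiplicative (`sufficesRightEqLeft_conclusion_iff_transport_multiplicative`):
"⇐" by `FrdI.T49.sufficesRightEqLeft_conclusion_of_forall_exists` (`Thm49FunctorialBaseIsos.lean`,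
seat abc-iut-w4-d035: naturality is automatic), "⇒" by uniqueness of the transport. So the one
non-formal step of the printed sentence above ("immediately from the construction") is exactly:
the transport is multiplicative at objects that are not Div-Frobenius-trivial (at Div-Frobenius-trivial
objects: `DivisorMonoidIsoDivFrobTrivial.lean`). Nothing here bears on [IUTchIII].
-/

namespace Literature.AlgebraicGeometry.Frobenioids

open CategoryTheory Opposite

namespace FrdI.T49

universe w v v' u u'

variable {D₁ : Type u} [Category.{v} D₁] {Φ₁ : D₁ᵒᵖ ⥤ CommMonCat.{w}} {C₁ : Type u'} [Category.{v'} C₁]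
  {D₂ : Type u} [Category.{v} D₂] {Φ₂ : D₂ᵒᵖ ⥤ CommMonCat.{w}} {C₂ : Type u'} [Category.{v'} C₂]
  {F₁ : C₁ ⥤ ElemFrobenioid Φ₁} {F₂ : C₂ ⥤ ElemFrobenioid Φ₂} {Ψ : C₁ ≌ C₂}

/-- **`SufficesRightEqLeft`'s conclusion from the multiplicativity of the divisor transports**
(p. 89 ll. 12–33): in a `T42.Setting`, if at every object `A` every map `T : Φ₁(A) → Φ₂(Ψ A)` with
`T(Div φ) = Div(Ψ φ)` for the pre-steps `φ` out of `A` is multiplicative, then there is a family of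
monoid isomorphisms `m_A : Φ₁(A) ≃* Φ₂(Ψ A)` with the pre-step clause, natural along every morphism
of `C₁`. [cite: MochizukiFrdI2008, Thm. 4.9 p.89] -/
theorem sufficesRightEqLeft_conclusion_of_transport_multiplicative (S : T42.Setting F₁ F₂ Ψ)
    (hmul : ∀ (A : C₁) (T : Φ₁.obj (op (PreFrobenioid.baseObj F₁ A)) →
        Φ₂.obj (op (PreFrobenioid.baseObj F₂ (Ψ.functor.obj A)))),
      (∀ ⦃B : C₁⦄ (φ : A ⟶ B), PreFrobenioid.IsPreStep F₁ φ →
        T (PreFrobenioid.Div F₁ φ) = PreFrobenioid.Div F₂ (Ψ.functor.map φ)) →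
      ∀ x y, T (x * y) = T x * T y) :
    ∃ m : ∀ A : C₁, Φ₁.obj (op (PreFrobenioid.baseObj F₁ A)) ≃*
        Φ₂.obj (op (PreFrobenioid.baseObj F₂ (Ψ.functor.obj A))),
      (∀ ⦃A B : C₁⦄ (φ : A ⟶ B), PreFrobenioid.IsPreStep F₁ φ →
          m A (PreFrobenioid.Div F₁ φ) = PreFrobenioid.Div F₂ (Ψ.functor.map φ)) ∧
      ∀ ⦃A B : C₁⦄ (φ : A ⟶ B) (x : Φ₁.obj (op (PreFrobenioid.baseObj F₁ B))),
        m A (pull Φ₁ (PreFrobenioid.Base F₁ φ) x) =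
          pull Φ₂ (PreFrobenioid.Base F₂ (Ψ.functor.map φ)) (m B x) := by
  refine sufficesRightEqLeft_conclusion_of_forall_exists S fun A => ?_
  obtain ⟨T, hTb, -, hT⟩ := PreFrobenioid.exists_divTransport Ψ S.isFrobenioid₁ S.isFrobenioid₂
    S.isotropic₁ S.isotropic₂ S.preStep_map S.preStep_inv A
  let f : Φ₁.obj (op (PreFrobenioid.baseObj F₁ A)) →ₙ*
      Φ₂.obj (op (PreFrobenioid.baseObj F₂ (Ψ.functor.obj A))) := ⟨T, hmul A T hT⟩
  exact ⟨MulEquiv.ofBijective f hTb, hT⟩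

/-- **Conversely** (uniqueness of the transport, Def. 1.3 (iii)(d)): a family `m_A` with the pre-step
clause makes every transport `T` at `A` equal to `m_A`, hence multiplicative.
[cite: MochizukiFrdI2008, Thm. 4.9 p.89] -/
theorem transport_multiplicative_of_family (S : T42.Setting F₁ F₂ Ψ)
    (m : ∀ A : C₁, Φ₁.obj (op (PreFrobenioid.baseObj F₁ A)) ≃*
        Φ₂.obj (op (PreFrobenioid.baseObj F₂ (Ψ.functor.obj A))))
    (hm : ∀ ⦃A B : C₁⦄ (φ : A ⟶ B), PreFrobenioid.IsPreStep F₁ φ →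
      m A (PreFrobenioid.Div F₁ φ) = PreFrobenioid.Div F₂ (Ψ.functor.map φ))
    (A : C₁) (T : Φ₁.obj (op (PreFrobenioid.baseObj F₁ A)) →
        Φ₂.obj (op (PreFrobenioid.baseObj F₂ (Ψ.functor.obj A))))
    (hT : ∀ ⦃B : C₁⦄ (φ : A ⟶ B), PreFrobenioid.IsPreStep F₁ φ →
      T (PreFrobenioid.Div F₁ φ) = PreFrobenioid.Div F₂ (Ψ.functor.map φ))
    (x y : Φ₁.obj (op (PreFrobenioid.baseObj F₁ A))) : T (x * y) = T x * T y := by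
  have hTm : ∀ z, T z = m A z := fun z => by
    obtain ⟨B, φ, hφ, rfl⟩ := S.isFrobenioid₁.iii_d_under_surj A z
    rw [hT φ hφ.2, hm φ hφ.2]
  rw [hTm, hTm, hTm, map_mul]

/-- **The hinge of row T49-L02, as an equivalence**: in a `T42.Setting`, the conclusion of
`FrdI.T49.SufficesRightEqLeft` holds iff the divisor transport is multiplicative at every object.
[cite: MochizukiFrdI2008, Thm. 4.9 p.89] -/
theorem sufficesRightEqLeft_conclusion_iff_transport_multiplicative (S : T42.Setting F₁ F₂ Ψ) :
    (∃ m : ∀ A : C₁, Φ₁.obj (op (PreFrobenioid.baseObj F₁ A)) ≃*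
        Φ₂.obj (op (PreFrobenioid.baseObj F₂ (Ψ.functor.obj A))),
      (∀ ⦃A B : C₁⦄ (φ : A ⟶ B), PreFrobenioid.IsPreStep F₁ φ →
          m A (PreFrobenioid.Div F₁ φ) = PreFrobenioid.Div F₂ (Ψ.functor.map φ)) ∧
      ∀ ⦃A B : C₁⦄ (φ : A ⟶ B) (x : Φ₁.obj (op (PreFrobenioid.baseObj F₁ B))),
        m A (pull Φ₁ (PreFrobenioid.Base F₁ φ) x) =
          pull Φ₂ (PreFrobenioid.Base F₂ (Ψ.functor.map φ)) (m B x)) ↔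
    ∀ (A : C₁) (T : Φ₁.obj (op (PreFrobenioid.baseObj F₁ A)) →
        Φ₂.obj (op (PreFrobenioid.baseObj F₂ (Ψ.functor.obj A)))),
      (∀ ⦃B : C₁⦄ (φ : A ⟶ B), PreFrobenioid.IsPreStep F₁ φ →
        T (PreFrobenioid.Div F₁ φ) = PreFrobenioid.Div F₂ (Ψ.functor.map φ)) →
      ∀ x y, T (x * y) = T x * T y :=
  ⟨fun ⟨m, hm, _⟩ A T hT x y => transport_multiplicative_of_family S m hm A T hT x y,
    sufficesRightEqLeft_conclusion_of_transport_multiplicative S⟩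

end FrdI.T49

end Literature.AlgebraicGeometry.Frobenioids
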